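import Literature.NumberTheory.DiophantineGeometry.GenEllDeCriticalLocus
import HarnessLib

/-!
# Good-prime reduction for the critical locus of `t` on `D_e` (GenEllTwo, support piece)

Companion of `GenEllDeCriticalLocus.lean` (same setting and sources: S. Mochizuki, *Arithmetic
elliptic curves in general position*, Math. J. Okayama Univ. 52 (2010), Thm. 2.1 proof p. 12
[cite: MochizukiGenEll2010]; abc-iut-S6 `GENELLTWO-P1ROUTE.md` §3 (d)). For an arbitrary
valuation `v` of a field `K` (e.g. the `w`-adic valuation of a number field at a finite place
`w`) with `v(2) = v(2k+1) = 1` ("good prime"), and a `v`-integral point `P = (x, r)` of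
`D_e : r^{2k+1} = x(1 − x)` with `v(N(P)) < 1` ("`w` divides `N(P)`"):

* `units_of_Nval_lt` — `r` and `s = 1 − 2x` are `v`-units (the prime does not see the poles of
  `t`);
* `map_Rpoly_lt_of_Nval_lt`, `exists_root_near` — `v(R(r)) < 1`, and if `R` splits in `K` then
  `r` is congruent to a root `θ` of `R`;
* `exists_critPoint_near` — **`P` is congruent modulo the prime to the ramification point
  `Q_θ = (x_θ, θ)`** (`v(r − θ) < 1`, `v(x − x_θ) < 1`), whose coordinates `θ`, `β(θ)`,
  `1 − 2x_θ` are `v`-units;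
* `exists_critValue_near` — consequently **`v(t(P) − t(Q_θ)) < 1`** for
  `t = (s + r^{k+2})/(r·s)`: a good prime dividing `N(P)` is a prime at which `t(P)` meets the
  critical-value set `A = t(R_t)` — the input of the summation in §3 (d) of the architecture note
  (the ramification credit `ord⁺_w N(P)` is only spent at primes where `t(P)` meets `B ⊇ A`).

Pure valuation-theoretic algebra (ultrametric inequalities); no named facts. Nothing here bears on
the disputed parts of the abc-iut corpus.
-/

noncomputable section

open Polynomial

namespace Literature.NumberTheory.DiophantineGeometry.GenEll

namespace DeCrit

section Valued

/-! ## Good-prime reduction: a prime dividing `N(P)` sees `P` congruent to a ramification point -/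

variable {K : Type*} [Field K] {Γ₀ : Type*} [LinearOrderedCommGroupWithZero Γ₀] (v : Valuation K Γ₀)

/-- In a linearly ordered commutative group with zero, `a ≤ 1` and `b < 1` give `a·b < 1`.
[folklore] -/
private theorem mul_lt_one_of_le_of_lt' {a b : Γ₀} (ha : a ≤ 1) (hb : b < 1) : a * b < 1 :=
  Right.mul_lt_one_of_le_of_lt ha hb

/-- Natural numbers have valuation `≤ 1`. [folklore] -/
private theorem map_natCast_le_one' (n : ℕ) : v (n : K) ≤ 1 := by
  induction n with
  | zero => simp
  | succ n ih =>
    push_cast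
    exact (v.map_add_le ih (le_of_eq v.map_one))

/-- Products preserve congruences modulo the maximal ideal: `a ≡ a'`, `b ≡ b'` (valuation of the
difference `< 1`), `a`, `b'` integral ⇒ `ab ≡ a'b'`. [folklore] -/
private theorem map_mul_sub_mul_lt {a a' b b' : K} (ha : v a ≤ 1) (hb' : v b' ≤ 1)
    (haa : v (a - a') < 1) (hbb : v (b - b') < 1) : v (a * b - a' * b') < 1 := by
  have : a * b - a' * b' = a * (b - b') + (a - a') * b' := by ring
  rw [this]
  refine v.map_add_lt ?_ ?_
  · rw [Valuation.map_mul]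
    exact mul_lt_one_of_le_of_lt' ha hbb
  · rw [Valuation.map_mul, mul_comm]
    exact mul_lt_one_of_le_of_lt' hb' haa

/-- Powers preserve congruences modulo the maximal ideal. [folklore] -/
private theorem map_pow_sub_pow_lt {a a' : K} (ha : v a ≤ 1) (ha' : v a' ≤ 1) (haa : v (a - a') < 1)
    (n : ℕ) : v (a ^ n - a' ^ n) < 1 := by
  induction n with
  | zero => simp
  | succ n ih =>
    rw [pow_succ, pow_succ]
    exact map_mul_sub_mul_lt v (by rw [Valuation.map_pow]; exact pow_le_one' ha n) ha' ih haa

/-- `α` preserves congruences modulo the maximal ideal. [cite: MochizukiGenEll2010, Thm 2.1 proof p.12] -/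
theorem map_alpha_sub_alpha_lt (k : ℕ) {a a' : K} (ha : v a ≤ 1) (ha' : v a' ≤ 1)
    (haa : v (a - a') < 1) : v (alpha k a - alpha k a') < 1 := by
  have e : alpha k a - alpha k a' =
      ((k : K) + 1) * (a ^ (k + 2) - a' ^ (k + 2)) - 2 * (a ^ (3 * k + 3) - a' ^ (3 * k + 3)) := by
    simp only [alpha]; ring
  rw [e]
  refine v.map_sub_lt ?_ ?_
  · rw [Valuation.map_mul]
    refine mul_lt_one_of_le_of_lt' ?_ (map_pow_sub_pow_lt v ha ha' haa _)
    have := map_natCast_le_one' v (k + 1)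
    push_cast at this
    exact this
  · rw [Valuation.map_mul]
    exact mul_lt_one_of_le_of_lt' (by exact_mod_cast map_natCast_le_one' v 2)
      (map_pow_sub_pow_lt v ha ha' haa _)

/-- `β` preserves congruences modulo the maximal ideal. [cite: MochizukiGenEll2010, Thm 2.1 proof p.12] -/
theorem map_beta_sub_beta_lt (k : ℕ) {a a' : K} (ha : v a ≤ 1) (ha' : v a' ≤ 1)
    (haa : v (a - a') < 1) : v (beta k a - beta k a') < 1 := by
  have e : beta k a - beta k a' = -(4 * (a ^ (2 * k + 1) - a' ^ (2 * k + 1))) := by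
    simp only [beta]; ring
  rw [e, Valuation.map_neg, Valuation.map_mul]
  exact mul_lt_one_of_le_of_lt' (by exact_mod_cast map_natCast_le_one' v 4)
    (map_pow_sub_pow_lt v ha ha' haa _)

/-- `α(r)` is integral when `r` is. [cite: MochizukiGenEll2010, Thm 2.1 proof p.12] -/
theorem map_alpha_le_one (k : ℕ) {r : K} (hr : v r ≤ 1) : v (alpha k r) ≤ 1 := by
  unfold alpha
  refine v.map_sub_le ?_ ?_
  · rw [Valuation.map_mul, Valuation.map_pow]
    refine mul_le_one' ?_ (pow_le_one' hr _)
    have := map_natCast_le_one' v (k + 1)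
    push_cast at this
    exact this
  · rw [Valuation.map_mul, Valuation.map_pow]
    exact mul_le_one' (by exact_mod_cast map_natCast_le_one' v 2) (pow_le_one' hr _)

/-- `β(r)` is integral when `r` is. [cite: MochizukiGenEll2010, Thm 2.1 proof p.12] -/
theorem map_beta_le_one (k : ℕ) {r : K} (hr : v r ≤ 1) : v (beta k r) ≤ 1 := by
  unfold beta
  refine v.map_sub_le (le_of_eq v.map_one) ?_
  rw [Valuation.map_mul, Valuation.map_pow]
  exact mul_le_one' (by exact_mod_cast map_natCast_le_one' v 4) (pow_le_one' hr _)

/-- On `D_e`, integrality of `r` forces integrality of `x` (`x(1 − x) = r^e`). [cite: MochizukiGenEll2010, Thm 2.1 proof p.12] -/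
theorem map_fst_le_one (k : ℕ) {x r : K} (h : r ^ (2 * k + 1) = x * (1 - x)) (hr : v r ≤ 1) :
    v x ≤ 1 := by
  by_contra hx
  rw [not_le] at hx
  have h1x : v (1 - x) = v x := by
    rw [sub_eq_add_neg, Valuation.map_add_eq_of_lt_right, Valuation.map_neg]
    rw [Valuation.map_neg, Valuation.map_one]
    exact hx
  have hprod : 1 < v (x * (1 - x)) := by
    rw [Valuation.map_mul, h1x]
    exact lt_of_lt_of_le hx (le_mul_of_one_le_right' hx.le)
  rw [← h, Valuation.map_pow] at hprod
  exact not_le.mpr hprod (pow_le_one' hr _)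

/-- On `D_e`, `s = 1 − 2x` is integral when `r` is. [cite: MochizukiGenEll2010, Thm 2.1 proof p.12] -/
theorem map_s_le_one (k : ℕ) {x r : K} (h : r ^ (2 * k + 1) = x * (1 - x)) (hr : v r ≤ 1) :
    v (1 - 2 * x) ≤ 1 := by
  refine v.map_sub_le (le_of_eq v.map_one) ?_
  rw [Valuation.map_mul]
  exact mul_le_one' (by exact_mod_cast map_natCast_le_one' v 2) (map_fst_le_one v k h hr)

/-- **A prime dividing `N(P)` does not see the poles of `t`**: if `P = (x, r) ∈ D_e` is
`v`-integral, `v(2) = v(2k+1) = 1` and `v(N(P)) < 1`, then `r` and `s = 1 − 2x` are `v`-units.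
[cite: MochizukiGenEll2010, Thm 2.1 proof p.12] -/
theorem units_of_Nval_lt (k : ℕ) (h2 : v 2 = 1) (he : v ((2 * k + 1 : ℕ) : K) = 1) {x r : K}
    (h : r ^ (2 * k + 1) = x * (1 - x)) (hr : v r ≤ 1) (hN : v (Nval k (x, r)) < 1) :
    v r = 1 ∧ v (1 - 2 * x) = 1 := by
  have hs := map_s_le_one v k h hr
  have hβs : beta k r = (1 - 2 * x) ^ 2 := beta_eq_sq_of_mem k h
  rw [Nval_eq_of_mem k h] at hN
  set s := 1 - 2 * x with hs_def
  have hα1 := map_alpha_le_one v k hr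
  have hβ1 := map_beta_le_one v k hr
  -- (a) `r` is a unit
  have hr1 : v r = 1 := by
    by_contra hr1
    have hr' : v r < 1 := lt_of_le_of_ne hr hr1
    -- `α(r)` and `β(r) − 1` are divisible by `r`
    have hα : v (alpha k r) < 1 := by
      have e : alpha k r = r * (((k : K) + 1) * r ^ (k + 1) - 2 * r ^ (3 * k + 2)) := by
        simp only [alpha]; ring
      rw [e, Valuation.map_mul, mul_comm]
      refine mul_lt_one_of_le_of_lt' ?_ hr'
      refine v.map_sub_le ?_ ?_
      · rw [Valuation.map_mul, Valuation.map_pow]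
        refine mul_le_one' ?_ (pow_le_one' hr _)
        have := map_natCast_le_one' v (k + 1)
        push_cast at this
        exact this
      · rw [Valuation.map_mul, Valuation.map_pow]
        exact mul_le_one' (by exact_mod_cast map_natCast_le_one' v 2) (pow_le_one' hr _)
    have hβ : v (beta k r - 1) < 1 := by
      have e : beta k r - 1 = r * (-(4 * r ^ (2 * k))) := by simp only [beta]; ring
      rw [e, Valuation.map_mul, mul_comm]
      refine mul_lt_one_of_le_of_lt' ?_ hr'
      rw [Valuation.map_neg, Valuation.map_mul, Valuation.map_pow]
      exact mul_le_one' (by exact_mod_cast map_natCast_le_one' v 4) (pow_le_one' hr _)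
    -- hence `s·β ≡ 0`, `s ≡ 0`, contradicting `s² = β ≡ 1`
    have hsβ : v (s * beta k r) < 1 := by
      have e : s * beta k r = alpha k r - (-(s * beta k r) + alpha k r) := by ring
      rw [e]
      exact v.map_sub_lt hα hN
    have hs0 : v s < 1 := by
      have e : s = s * beta k r - s * (beta k r - 1) := by ring
      rw [e]
      refine v.map_sub_lt hsβ ?_
      rw [Valuation.map_mul]
      exact mul_lt_one_of_le_of_lt' hs hβ
    have : v (1 : K) < 1 := by
      have e : (1 : K) = s * s - (beta k r - 1) := by rw [hβs]; ring
      rw [e]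
      refine v.map_sub_lt ?_ hβ
      rw [Valuation.map_mul]
      exact mul_lt_one_of_le_of_lt' hs hs0
    rw [Valuation.map_one] at this
    exact lt_irrefl _ this
  refine ⟨hr1, ?_⟩
  -- (b) `s` is a unit
  by_contra hs1
  have hs' : v s < 1 := lt_of_le_of_ne hs hs1
  have hβ : v (beta k r) < 1 := by
    rw [hβs, Valuation.map_pow]
    exact mul_lt_one_of_le_of_lt' hs hs' |> (by rw [pow_two]; exact ·)
  have hα : v (alpha k r) < 1 := by
    have e : alpha k r = (-(s * beta k r) + alpha k r) + s * beta k r := by ring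
    rw [e]
    refine v.map_add_lt hN ?_
    rw [Valuation.map_mul]
    exact mul_lt_one_of_le_of_lt' hs hβ
  -- `(2k+1)·r^{k+2} = 2α − r^{k+2}·β` would then be a non-unit
  have hid : ((2 * k + 1 : ℕ) : K) * r ^ (k + 2) = 2 * alpha k r - r ^ (k + 2) * beta k r := by
    simp only [alpha, beta]; push_cast; ring
  have hlt : v (((2 * k + 1 : ℕ) : K) * r ^ (k + 2)) < 1 := by
    rw [hid]
    refine v.map_sub_lt ?_ ?_
    · rw [Valuation.map_mul, h2, one_mul]; exact hα
    · rw [Valuation.map_mul, Valuation.map_pow, hr1, one_pow, one_mul]; exact hβ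
  rw [Valuation.map_mul, Valuation.map_pow, he, hr1, one_pow, one_mul] at hlt
  exact lt_irrefl _ hlt

/-- If `v(N(P)) < 1` for a `v`-integral point `P = (x, r) ∈ D_e`, then `v(R(r)) < 1`
(`R = (α − sβ)(α + sβ)` on the curve). [cite: MochizukiGenEll2010, Thm 2.1 proof p.12] -/
theorem map_Rpoly_lt_of_Nval_lt (k : ℕ) {x r : K} (h : r ^ (2 * k + 1) = x * (1 - x))
    (hr : v r ≤ 1) (hN : v (Nval k (x, r)) < 1) : v (aeval r (Rpoly k)) < 1 := by
  have hs := map_s_le_one v k h hr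
  have e : aeval r (Rpoly k) =
      (-((1 - 2 * x) * beta k r) + alpha k r) * (alpha k r + (1 - 2 * x) * beta k r) := by
    rw [aeval_Rpoly]
    have hβs := beta_eq_sq_of_mem k h
    linear_combination (-(beta k r) ^ 2) * hβs
  rw [e, Valuation.map_mul, mul_comm]
  rw [Nval_eq_of_mem k h] at hN
  refine mul_lt_one_of_le_of_lt' ?_ hN
  refine v.map_add_le (map_alpha_le_one v k hr) ?_
  rw [Valuation.map_mul]
  exact mul_le_one' hs (map_beta_le_one v k hr)

/-- If `R` splits in `K` and `v(R(r)) < 1` with `v(2) = 1`, then `r` is `v`-adically close to a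
root of `R`. [cite: MochizukiGenEll2010, Thm 2.1 proof p.12] -/
theorem exists_root_near (k : ℕ) (h2 : v 2 = 1) (hsplit : ((Rpoly k).map (algebraMap ℤ K)).Splits)
    {r : K} (hR : v (aeval r (Rpoly k)) < 1) :
    ∃ θ : K, aeval θ (Rpoly k) = 0 ∧ v (r - θ) < 1 := by
  classical
  have h4 : v (4 : K) = 1 := by
    have : (4 : K) = 2 * 2 := by norm_num
    rw [this, Valuation.map_mul, h2, one_mul]
  have h40 : (4 : K) ≠ 0 := fun h0 => by rw [h0, Valuation.map_zero] at h4; exact zero_ne_one h4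
  set f := (Rpoly k).map (algebraMap ℤ K) with hf
  have hprod := hsplit.eq_prod_roots
  have hlc : f.leadingCoeff = 4 := by
    rw [hf, leadingCoeff_map_of_leadingCoeff_ne_zero _
      (by rw [leadingCoeff_Rpoly]; simpa using h40), leadingCoeff_Rpoly]
    simp
  have hev : aeval r (Rpoly k) = 4 * (f.roots.map (fun a => r - a)).prod := by
    rw [← eval_map_algebraMap, ← hf]
    conv_lhs => rw [hprod]
    rw [eval_mul, eval_C, hlc, eval_multiset_prod, Multiset.map_map]
    congr 1
    congr 1
    refine Multiset.map_congr rfl fun a _ => ?_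
    simp
  rw [hev, Valuation.map_mul, h4, one_mul, map_multiset_prod v, Multiset.map_map] at hR
  -- some factor has valuation `< 1`
  by_contra hcon
  simp only [not_exists, not_and, not_lt] at hcon
  have hge : 1 ≤ (Multiset.map (⇑v ∘ fun a => r - a) f.roots).prod := by
    refine Multiset.one_le_prod_of_one_le fun y hy => ?_
    obtain ⟨a, ha, rfl⟩ := Multiset.mem_map.mp hy
    have haR : aeval a (Rpoly k) = 0 := by
      rw [← eval_map_algebraMap, ← hf]
      exact (mem_roots (hf ▸ Rpoly_map_ne_zero k)).mp ha
    exact hcon a haR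
  exact not_lt.mpr hge hR

/-- **Good-prime reduction.** Let `v` be a valuation of the field `K` with `v(2) = v(2k+1) = 1`
over which `R` splits, and `P = (x, r) ∈ D_e(K)` a `v`-integral point with `v(N(P)) < 1`. Then
`P` is `v`-adically congruent to a ramification point `Q_θ = (x_θ, θ)` of `t` (`θ` a root of
`R`): `v(r − θ) < 1`, `v(x − x_θ) < 1`, and `β(θ)`, `θ`, `1 − 2x_θ` are `v`-units.
[cite: MochizukiGenEll2010, Thm 2.1 proof p.12] -/
theorem exists_critPoint_near (k : ℕ) (h2 : v 2 = 1) (he : v ((2 * k + 1 : ℕ) : K) = 1)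
    (hsplit : ((Rpoly k).map (algebraMap ℤ K)).Splits) {x r : K}
    (h : r ^ (2 * k + 1) = x * (1 - x)) (hr : v r ≤ 1) (hN : v (Nval k (x, r)) < 1) :
    ∃ θ : K, aeval θ (Rpoly k) = 0 ∧ v (r - θ) < 1 ∧ v (x - critX k θ) < 1 ∧
      v θ = 1 ∧ v (beta k θ) = 1 ∧ v (1 - 2 * critX k θ) = 1 := by
  obtain ⟨hr1, hs1⟩ := units_of_Nval_lt v k h2 he h hr hN
  obtain ⟨θ, hθR, hθ⟩ := exists_root_near v k h2 hsplit (map_Rpoly_lt_of_Nval_lt v k h hr hN)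
  have h2K : (2 : K) ≠ 0 := by
    intro h0; rw [h0, Valuation.map_zero] at h2; exact zero_ne_one h2
  have heK : ((2 * k + 1 : ℕ) : K) ≠ 0 := by
    intro h0; rw [h0, Valuation.map_zero] at he; exact zero_ne_one he
  -- `θ` is a unit congruent to `r`
  have hθ1 : v θ = 1 := by
    have e : θ = r + -(r - θ) := by ring
    rw [e, Valuation.map_add_eq_of_lt_left, hr1]
    rw [Valuation.map_neg, hr1]; exact hθ
  have hθle : v θ ≤ 1 := hθ1.le
  -- `β(θ) ≡ β(r) = s²` is a unit
  have hββ : v (beta k r - beta k θ) < 1 := map_beta_sub_beta_lt v k hr hθle hθ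
  have hβs : beta k r = (1 - 2 * x) ^ 2 := beta_eq_sq_of_mem k h
  have hβr1 : v (beta k r) = 1 := by rw [hβs, Valuation.map_pow, hs1, one_pow]
  have hβθ1 : v (beta k θ) = 1 := by
    have e : beta k θ = beta k r + -(beta k r - beta k θ) := by ring
    rw [e, Valuation.map_add_eq_of_lt_left, hβr1]
    rw [Valuation.map_neg, hβr1]; exact hββ
  have hβθ : beta k θ ≠ 0 := by
    intro h0; rw [h0, Valuation.map_zero] at hβθ1; exact zero_ne_one hβθ1
  -- `s ≡ α(θ)/β(θ) = s_θ`
  set s := 1 - 2 * x with hs_def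
  rw [Nval_eq_of_mem k h] at hN
  have hαα : v (alpha k r - alpha k θ) < 1 := map_alpha_sub_alpha_lt v k hr hθle hθ
  have hnum : v (beta k θ * s - alpha k θ) < 1 := by
    have e : beta k θ * s - alpha k θ =
        -(beta k r - beta k θ) * s + (-(-(s * beta k r) + alpha k r) + (alpha k r - alpha k θ)) := by
      ring
    rw [e]
    refine v.map_add_lt ?_ (v.map_add_lt (by rw [Valuation.map_neg]; exact hN) hαα)
    rw [Valuation.map_mul, Valuation.map_neg, mul_comm]
    exact mul_lt_one_of_le_of_lt' hs1.le hββ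
  have hsθ : v (s - critS k θ) < 1 := by
    have e : s - critS k θ = (beta k θ)⁻¹ * (beta k θ * s - alpha k θ) := by
      unfold critS; field_simp
    rw [e, Valuation.map_mul, map_inv₀, hβθ1, inv_one, one_mul]
    exact hnum
  have hxθ : v (x - critX k θ) < 1 := by
    have e : x - critX k θ = -((2 : K)⁻¹ * (s - critS k θ)) := by
      unfold critX; rw [hs_def]; field_simp; ring
    rw [e, Valuation.map_neg, Valuation.map_mul, map_inv₀, h2, inv_one, one_mul]
    exact hsθ
  have hsθ1 : v (1 - 2 * critX k θ) = 1 := by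
    rw [one_sub_two_mul_critX k h2K]
    have e : critS k θ = s + -(s - critS k θ) := by ring
    rw [e, Valuation.map_add_eq_of_lt_left, hs1]
    rw [Valuation.map_neg, hs1]; exact hsθ
  exact ⟨θ, hθR, hθ, hxθ, hθ1, hβθ1, hsθ1⟩

/-- Quotients of congruent integral quantities with unit denominators are congruent: the form in
which the reduction is consumed for `t = (s + r^{k+2})/(r·s)` (numerator and denominator are
polynomials in the coordinates, the denominator a unit at `P` and at `Q_θ`).  [folklore] -/
private theorem map_div_sub_div_lt {a a' b b' : K} (ha : v a ≤ 1) (hb : v b = 1) (hb' : v b' = 1)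
    (haa : v (a - a') < 1) (hbb : v (b - b') < 1) : v (a / b - a' / b') < 1 := by
  have hb0 : b ≠ 0 := by intro h0; rw [h0, Valuation.map_zero] at hb; exact zero_ne_one hb
  have hb0' : b' ≠ 0 := by intro h0; rw [h0, Valuation.map_zero] at hb'; exact zero_ne_one hb'
  have e : a / b - a' / b' = (b * b')⁻¹ * (a * b' - a' * b) := by field_simp
  rw [e, Valuation.map_mul, map_inv₀, Valuation.map_mul, hb, hb', one_mul, inv_one, one_mul]
  have hbb' : v (b' - b) < 1 := by rw [Valuation.map_sub_swap]; exact hbb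
  exact map_mul_sub_mul_lt v ha hb.le haa hbb'

/-- **The value `t(P)` reduces to the critical value `t(Q_θ)`**: under the hypotheses of
`exists_critPoint_near`, with `t = (s + r^{k+2})/(r·s)` (`s = 1 − 2x`),
`v(t(P) − t(Q_θ)) < 1` for the ramification point `Q_θ` found there — "a good prime dividing
`N(P)` is a prime at which `t(P)` meets the critical-value divisor `A = t(R_t)`".
[cite: MochizukiGenEll2010, Thm 2.1 proof p.12] -/
theorem exists_critValue_near (k : ℕ) (h2 : v 2 = 1) (he : v ((2 * k + 1 : ℕ) : K) = 1)
    (hsplit : ((Rpoly k).map (algebraMap ℤ K)).Splits) {x r : K}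
    (h : r ^ (2 * k + 1) = x * (1 - x)) (hr : v r ≤ 1) (hN : v (Nval k (x, r)) < 1) :
    ∃ θ : K, aeval θ (Rpoly k) = 0 ∧ v (r - θ) < 1 ∧ v (x - critX k θ) < 1 ∧
      v (((1 - 2 * x) + r ^ (k + 2)) / (r * (1 - 2 * x)) -
        ((1 - 2 * critX k θ) + θ ^ (k + 2)) / (θ * (1 - 2 * critX k θ))) < 1 := by
  obtain ⟨θ, hθR, hθ, hxθ, hθ1, -, hsθ1⟩ := exists_critPoint_near v k h2 he hsplit h hr hN
  obtain ⟨hr1, hs1⟩ := units_of_Nval_lt v k h2 he h hr hN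
  have hx1 := map_fst_le_one v k h hr
  have hxθ1 : v (critX k θ) ≤ 1 := by
    have e : critX k θ = x + -(x - critX k θ) := by ring
    rw [e]
    refine v.map_add_le hx1 ?_
    rw [Valuation.map_neg]; exact hxθ.le
  have hss : v ((1 - 2 * x) - (1 - 2 * critX k θ)) < 1 := by
    have e : (1 - 2 * x) - (1 - 2 * critX k θ) = -(2 * (x - critX k θ)) := by ring
    rw [e, Valuation.map_neg, Valuation.map_mul, h2, one_mul]; exact hxθ
  refine ⟨θ, hθR, hθ, hxθ, map_div_sub_div_lt v ?_ ?_ ?_ ?_ ?_⟩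
  · exact v.map_add_le (map_s_le_one v k h hr) (by rw [Valuation.map_pow]; exact pow_le_one' hr _)
  · rw [Valuation.map_mul, hr1, hs1, one_mul]
  · rw [Valuation.map_mul, hθ1, hsθ1, one_mul]
  · have e : (1 - 2 * x) + r ^ (k + 2) - ((1 - 2 * critX k θ) + θ ^ (k + 2)) =
        ((1 - 2 * x) - (1 - 2 * critX k θ)) + (r ^ (k + 2) - θ ^ (k + 2)) := by ring
    rw [e]
    exact v.map_add_lt hss (map_pow_sub_pow_lt v hr hθ1.le hθ _)
  · exact map_mul_sub_mul_lt v hr hsθ1.le hθ hss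

end Valued

end DeCrit

end Literature.NumberTheory.DiophantineGeometry.GenEll

end
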